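import Literature.AlgebraicGeometry.Resolution.TransverseCentreEffectiveCartier
import Literature.AlgebraicGeometry.Resolution.StrictTransformSupport
import Literature.AlgebraicGeometry.Resolution.RegularSubschemeLocallyIrreducible
import Literature.AlgebraicGeometry.Resolution.ResolutionOfCurves
import Literature.AlgebraicGeometry.Resolution.RegularBlowup
import Literature.AlgebraicGeometry.Resolution.BlowupOffCentre
import Literature.AlgebraicGeometry.Resolution.NormalCrossingsBlowupStepReduction
import Literature.AlgebraicGeometry.Resolution.PointBlowupHilbertSamuelStrata
import Literature.AlgebraicGeometry.Resolution.BlowupStalkCharts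
import Literature.AlgebraicGeometry.Resolution.CohenMacaulayCatenary
import Literature.AlgebraicGeometry.Resolution.AdicCompletionRegular
import HarnessLib

/-!
# Strict transforms of transverse regular curves under the blowing up of a regular centre
# (CoP1, proof of Prop. 4.4, p. 10: "the strict transform of `Σ` in `X′` is transverse to the exceptional divisor")

Topic: `Literature/AlgebraicGeometry/Resolution`. [CoP1] = Cossart–Piltant, J. Algebra 320 (2008)
1051–1082, proof of Prop. 4.4, p. 10: "note that under assumption (4) in lemma 4.3, the strict transform of
`Σ` in `X′` is transverse to the exceptional divisor, hence to `Γ′` if all components of `Γ` meet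
transversally" — the input that keeps the transversality structure (**) of the one-dimensional singular locus
across the CURVE steps of the algorithm (p. 10, steps 3–4). PROVED here, chart-free, for the blowing up
`π : X′ → X` (`IsBlowup`, universal property) of a regular locally Noetherian scheme `X` along a closed subset
`Y` with regular reduced structure, and a closed subset `C ⊆ X` whose reduced ideal is generated at each point
of `C` by a PAIR of elements of a regular system of parameters and which is transverse to `Y`
(`𝓘_{C,x} + 𝓘_{Y,x} = 𝔪_x`) at the points of `C ∩ Y`, threefold points (`dim 𝒪_{X,x} = 3`; in `𝔸⁴` with
`Y` a curve and `C` a surface the transversality conclusion fails):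

* `IsBlowup.ringKrullDim_stalk_eq_of_residuallyRational_of_isDomain` — the dimension formula
  `dim 𝒪_{X′,x′} = dim 𝒪_{X,π x′}` at a residually rational point over a universally catenary local domain
  (Matsumura 15.6; the variant of `IsBlowup.ringKrullDim_stalk_eq_of_residuallyRational` of
  `PointBlowupHilbertSamuelStrata.lean` without integrality of `X`);
* `exists_iso_subscheme_strictTransformIdeal_of_transverse` — the schematic strict transform
  `V(⋃ₙ (π^*𝓘_C : 𝓘_Eⁿ))` is `Bl_{𝓘_Y 𝒪_C} C ≅ C` over `X` (Stacks 080E/0807 with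
  `isEffectiveCartier_comap_subschemeι_of_transverse`);
* `vanishingIdeal_closure_eq_strictTransformIdeal_of_transverse` — hence it is reduced and regular, and its
  ideal IS the reduced ideal `𝓘_{C̃}` of the closed set `C̃ = cl(π⁻¹(C ∖ Y))`;
* `exists_sub_stalkMap_mem_stalkIdeal_strictTransformIdeal_of_transverse` — `𝒪_{X,π c′} → 𝒪_{X′,c′}/𝓘_{C̃,c′}`
  is onto (`c′` is residually rational over `π c′`);
* `ringKrullDim_stalk_quotient_strictTransformIdeal_of_transverse`, `ringKrullDim_stalk_eq_three_of_transverse`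
  — over `Y`: `dim 𝒪_{X′,c′}/𝓘_{C̃,c′} = 1` and `dim 𝒪_{X′,c′} = 3`;
* `exists_isRsopPart_strictTransform_of_transverse` — **at every `c′ ∈ C̃` the ideal `𝓘_{C̃,c′}` is
  generated by a pair of elements of a regular system of parameters of `𝒪_{X′,c′}` (Matsumura 14.2), and
  over `Y` it is transverse to the exceptional divisor: `𝓘_{C̃,c′} + 𝓘_Y 𝒪_{X′,c′} = 𝔪_{c′}`.** Off `Y` the
  blowing up is a local isomorphism (`BlowupOffCentre.lean`).

This is the brick T2c of the F-71 census (cell res-hironaka, `plan/inputs/F71-CENSUS-v2.md`); the chain-route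
stub `stub_T2c_strictTransform_regular_transverse` (candidates `F71_T1_T4_SIGNATURES.lean` v3) follows from the
last theorem by `exact` (its hypotheses `hYirr`, `hCirr`, `hCY` are not needed). No definitions, no named
facts; `CossartPiltant2008_prop44` itself is NOT proved here.

## Sources

* V. Cossart, O. Piltant, J. Algebra 320 (2008) 1051–1082, proof of Prop. 4.4, p. 10. [CossartPiltant2008]
* The Stacks Project, Tags 080E (Divisors, Lemma 31.34.2), 0807, 0BI7. [StacksProject]
* H. Matsumura, *Commutative Ring Theory* (1986), Thms. 14.2, 15.6. [Matsumura1987]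
* U. Görtz, T. Wedhorn, *Algebraic Geometry I*, 2nd ed. (2020), (13.19) p. 414. [GortzWedhorn2020]
* V. Cossart, U. Jannsen, S. Saito, LNM 2270 (2020), proof of Thm. 3.10, (3.8). [CossartJannsenSaito2020]
-/

noncomputable section

open CategoryTheory CategoryTheory.Limits AlgebraicGeometry TopologicalSpace IsLocalRing

namespace Literature.AlgebraicGeometry.Resolution

universe u

open Scheme.IdealSheafData

variable {X X' : Scheme.{u}}

/-! ## The dimension formula at a residually rational point of a blowing up -/

variable {π : X' ⟶ X} {J : X.IdealSheafData} in
/-- **`dim 𝒪_{X',x'} = dim 𝒪_{X,x}` at a residually rational point `x'` of a blowing up** over a point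
`x = π x'` whose local ring is a universally catenary domain (Matsumura Thm. 15.6 on a chart
`𝒪_{X,x}[J_x/c_j]`, `ringKrullDim_localization_chartRing_eq_of_residuallyRational`, read at `x'` through
`IsBlowup.exists_reesChart_stalk`); the variant of `IsBlowup.ringKrullDim_stalk_eq_of_residuallyRational`
without the integrality hypothesis on `X`. [cite: Matsumura1987, Thm. 15.6]
[cite: CossartJannsenSaito2020, proof of Thm. 3.10, (3.8) (p. 44)] -/
theorem IsBlowup.ringKrullDim_stalk_eq_of_residuallyRational_of_isDomain [IsLocallyNoetherian X]
    (hπ : IsBlowup π J) (x' : X') [IsDomain (X.presheaf.stalk (π.base x'))]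
    (hUC : IsUniversallyCatenaryRing (X.presheaf.stalk (π.base x')))
    (hres : ∀ y : X'.presheaf.stalk x', ∃ r : X.presheaf.stalk (π.base x'),
      y - (π.stalkMap x').hom r ∈ IsLocalRing.maximalIdeal (X'.presheaf.stalk x')) :
    ringKrullDim (X'.presheaf.stalk x') = ringKrullDim (X.presheaf.stalk (π.base x')) := by
  obtain ⟨k, c, hc⟩ := Submodule.fg_iff_exists_fin_generating_family.mp
    (IsNoetherian.noetherian (stalkIdeal J (π.base x')))
  obtain ⟨j, 𝔴, χ, hχ, hloc, h𝔴⟩ := hπ.exists_reesChart_stalk x' c hc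
  letI := χ.toAlgebra
  haveI : IsLocalization.AtPrime (X'.presheaf.stalk x') 𝔴.asIdeal := hloc
  have hmem : ∀ b : chartRing c j,
      χ b ∈ IsLocalRing.maximalIdeal (X'.presheaf.stalk x') ↔ b ∈ 𝔴.asIdeal := fun b =>
    IsLocalization.AtPrime.to_map_mem_maximal_iff (X'.presheaf.stalk x') 𝔴.asIdeal b
  have hχc : (π.stalkMap x').hom = χ.comp (chartBase c j) := RingHom.ext fun r => (hχ r).symm
  refine ringKrullDim_localization_chartRing_eq_of_residuallyIntegral c j hUC 𝔴.asIdeal h𝔴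
    (fun b => ?_) (X'.presheaf.stalk x')
  obtain ⟨r, hr⟩ := hres (χ b)
  refine ⟨Polynomial.X - Polynomial.C r, Polynomial.monic_X_sub_C r, (hmem _).mp ?_⟩
  rw [Polynomial.map_sub, Polynomial.map_X, Polynomial.map_C, Polynomial.eval_sub, Polynomial.eval_X,
    Polynomial.eval_C, map_sub, hχ]
  exact hr

/-! ## The strict transform of a transverse regular curve -/

/-- Surjectivity of a composition in `CommRingCat` from surjectivity of the factors. [folklore] -/
private theorem surjective_hom_comp {A B D : CommRingCat.{u}} {f : A ⟶ B} {g : B ⟶ D}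
    (hf : Function.Surjective f.hom) (hg : Function.Surjective g.hom) :
    Function.Surjective (f ≫ g).hom := by
  rw [CommRingCat.hom_comp]
  exact hg.comp hf

section StrictTransform

variable [IsLocallyNoetherian X] [IsLocallyNoetherian X'] {π : X' ⟶ X} {Y C : Closeds X}
  (hπ : IsBlowup π (vanishingIdeal Y))
  (hCreg : ∀ x ∈ (C : Set X), ∃ c : Fin 2 → X.presheaf.stalk x,
    IsRsopPart c ∧ Ideal.span (Set.range c) = stalkIdeal (vanishingIdeal C) x)
  (htr : ∀ x ∈ (C : Set X) ∩ Y,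
    stalkIdeal (vanishingIdeal C) x ⊔ stalkIdeal (vanishingIdeal Y) x = maximalIdeal _)
  (hdim : ∀ x ∈ (C : Set X) ∩ Y, ringKrullDim (X.presheaf.stalk x) = 3)

include hπ hCreg htr hdim

omit [IsLocallyNoetherian X'] in
/-- **The schematic strict transform of `C` is `C`**: `V(⋃ₙ (π^*𝓘_C : 𝓘_Eⁿ)) ≅ V(𝓘_C)` over `X` (Stacks
080E/0807: it is the blowing up of `C` along the effective Cartier divisor `𝓘_Y 𝒪_C`).
[cite: StacksProject, Tag 080E] [cite: CossartPiltant2008, Prop. 4.4 (proof, p. 10)] -/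
theorem exists_iso_subscheme_strictTransformIdeal_of_transverse :
    ∃ e : (strictTransformIdeal π (vanishingIdeal Y) (vanishingIdeal C)).subscheme ≅
        (vanishingIdeal C).subscheme,
      e.hom ≫ (vanishingIdeal C).subschemeι =
        (strictTransformIdeal π (vanishingIdeal Y) (vanishingIdeal C)).subschemeι ≫ π := by
  have hiso := exists_iso_subscheme_strictTransformIdeal hπ (vanishingIdeal C).subschemeι
    (isEffectiveCartier_comap_subschemeι_of_transverse hCreg htr hdim)
  rw [ker_subschemeι] at hiso
  exact hiso

/-- **The schematic strict transform of `C` is reduced and regular, and its ideal is the reduced ideal of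
the closed set `C̃ = cl(π⁻¹(C ∖ Y))`.** [cite: GortzWedhorn2020, (13.19) p. 414]
[cite: CossartPiltant2008, Prop. 4.4 (proof, p. 10)] -/
theorem vanishingIdeal_closure_eq_strictTransformIdeal_of_transverse :
    vanishingIdeal (⟨closure (π ⁻¹' ((C : Set X) \ Y)), isClosed_closure⟩ : Closeds X') =
        strictTransformIdeal π (vanishingIdeal Y) (vanishingIdeal C) ∧
      Scheme.IsRegular (strictTransformIdeal π (vanishingIdeal Y) (vanishingIdeal C)).subscheme := by
  obtain ⟨e, -⟩ := exists_iso_subscheme_strictTransformIdeal_of_transverse hπ hCreg htr hdim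
  have hKreg : Scheme.IsRegular (vanishingIdeal C).subscheme :=
    isRegular_subscheme_vanishingIdeal_of_forall_isRsopPart fun x hx => by
      obtain ⟨c, hc, h⟩ := hCreg x hx
      exact ⟨2, c, hc, h⟩
  haveI : IsReduced (vanishingIdeal C).subscheme := isReduced_subscheme_vanishingIdeal C
  haveI : IsReduced (strictTransformIdeal π (vanishingIdeal Y) (vanishingIdeal C)).subscheme :=
    isReduced_of_isOpenImmersion e.hom
  refine ⟨?_, Scheme.IsRegular.of_isOpenImmersion e.hom hKreg⟩
  have hsuppC : (strictTransformIdeal π (vanishingIdeal Y) (vanishingIdeal C)).support =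
      (⟨closure (π ⁻¹' ((C : Set X) \ Y)), isClosed_closure⟩ : Closeds X') := by
    apply TopologicalSpace.Closeds.ext
    rw [support_strictTransformIdeal_eq_closure, coe_support_vanishingIdeal, coe_support_vanishingIdeal]
    rfl
  rw [← hsuppC]
  exact eq_vanishingIdeal_support_of_isReduced_subscheme _

omit [IsLocallyNoetherian X'] in
/-- **`𝒪_{X,π c'} → 𝒪_{X',c'}/𝓘_{C̃,c'}` is onto** at every point `c'` of the strict transform: it is
`𝒪_{X,π c'} ↠ 𝒪_{C,π c'} ≅ 𝒪_{C̃,c'}`. [cite: StacksProject, Tag 080E]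
[cite: CossartPiltant2008, Prop. 4.4 (proof, p. 10)] -/
theorem exists_sub_stalkMap_mem_stalkIdeal_strictTransformIdeal_of_transverse
    (v' : (strictTransformIdeal π (vanishingIdeal Y) (vanishingIdeal C)).subscheme)
    (y : X'.presheaf.stalk ((strictTransformIdeal π (vanishingIdeal Y) (vanishingIdeal C)).subschemeι v')) :
    ∃ a : X.presheaf.stalk (π ((strictTransformIdeal π (vanishingIdeal Y) (vanishingIdeal C)).subschemeι v')),
      y - (π.stalkMap _).hom a ∈ stalkIdeal (strictTransformIdeal π (vanishingIdeal Y) (vanishingIdeal C))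
        ((strictTransformIdeal π (vanishingIdeal Y) (vanishingIdeal C)).subschemeι v') := by
  obtain ⟨e, he⟩ := exists_iso_subscheme_strictTransformIdeal_of_transverse hπ hCreg htr hdim
  have hsurjX : Function.Surjective
      ((((strictTransformIdeal π (vanishingIdeal Y) (vanishingIdeal C)).subschemeι) ≫ π).stalkMap v').hom := by
    rw [Scheme.Hom.stalkMap_congr_hom _ _ he.symm v', Scheme.Hom.stalkMap_comp]
    refine surjective_hom_comp (ConcreteCategory.bijective_of_isIso _).2 (surjective_hom_comp ?_ ?_)
    · exact (vanishingIdeal C).subschemeι.stalkMap_surjective _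
    · exact (ConcreteCategory.bijective_of_isIso _).2
  obtain ⟨a, ha⟩ := hsurjX
    ((((strictTransformIdeal π (vanishingIdeal Y) (vanishingIdeal C)).subschemeι).stalkMap v').hom y)
  refine ⟨a, ?_⟩
  have hker := stalkIdeal_ker_eq_ker_stalkMap
    (strictTransformIdeal π (vanishingIdeal Y) (vanishingIdeal C)).subschemeι v'
  rw [ker_subschemeι] at hker
  rw [hker, RingHom.mem_ker, map_sub, sub_eq_zero, ← ha, Scheme.Hom.stalkMap_comp]
  rfl

omit [IsLocallyNoetherian X'] in
/-- **`dim 𝒪_{X',c'}/𝓘_{C̃,c'} = 1`** at a point `c'` of the strict transform over `Y`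
(`𝒪_{X',c'}/𝓘_{C̃,c'} ≅ 𝒪_{C̃,c'} ≅ 𝒪_{C,π c'} = 𝒪_{X,π c'}/𝓘_{C,π c'}`, a quotient of a three-dimensional regular
local ring by two regular parameters). [cite: CossartPiltant2008, Prop. 4.4 (proof, p. 10)] [cite: Matsumura1987, Thm. 14.2] -/
theorem ringKrullDim_stalk_quotient_strictTransformIdeal_of_transverse
    (v' : (strictTransformIdeal π (vanishingIdeal Y) (vanishingIdeal C)).subscheme)
    (hxY : π ((strictTransformIdeal π (vanishingIdeal Y) (vanishingIdeal C)).subschemeι v') ∈ (Y : Set X)) :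
    ringKrullDim (X'.presheaf.stalk ((strictTransformIdeal π (vanishingIdeal Y) (vanishingIdeal C)).subschemeι v') ⧸
      stalkIdeal (strictTransformIdeal π (vanishingIdeal Y) (vanishingIdeal C))
        ((strictTransformIdeal π (vanishingIdeal Y) (vanishingIdeal C)).subschemeι v')) = 1 := by
  obtain ⟨e, he⟩ := exists_iso_subscheme_strictTransformIdeal_of_transverse hπ hCreg htr hdim
  have hx₁ : (vanishingIdeal C).subschemeι (e.hom v') =
      π ((strictTransformIdeal π (vanishingIdeal Y) (vanishingIdeal C)).subschemeι v') := by
    rw [← Scheme.Hom.comp_apply, he, Scheme.Hom.comp_apply]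
  have hx₁C : (vanishingIdeal C).subschemeι (e.hom v') ∈ (C : Set X) :=
    mem_of_subscheme_vanishingIdeal C (e.hom v')
  have hx₁Y : (vanishingIdeal C).subschemeι (e.hom v') ∈ (Y : Set X) := by
    rw [hx₁]; exact hxY
  obtain ⟨c₀, hc₀, hspan₀⟩ := hCreg _ hx₁C
  have hker : RingHom.ker (((strictTransformIdeal π (vanishingIdeal Y) (vanishingIdeal C)).subschemeι).stalkMap v').hom =
      stalkIdeal (strictTransformIdeal π (vanishingIdeal Y) (vanishingIdeal C))
        ((strictTransformIdeal π (vanishingIdeal Y) (vanishingIdeal C)).subschemeι v') := by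
    have h := stalkIdeal_ker_eq_ker_stalkMap
      (strictTransformIdeal π (vanishingIdeal Y) (vanishingIdeal C)).subschemeι v'
    rw [ker_subschemeι] at h
    exact h.symm
  have hkerC : RingHom.ker ((vanishingIdeal C).subschemeι.stalkMap (e.hom v')).hom =
      Ideal.span (Set.range c₀) := by
    have h := stalkIdeal_ker_eq_ker_stalkMap (vanishingIdeal C).subschemeι (e.hom v')
    rw [ker_subschemeι] at h
    rw [← h, hspan₀]
  let e₁ := (Ideal.quotEquivOfEq hker.symm).trans (RingHom.quotientKerEquivOfSurjective
    (((strictTransformIdeal π (vanishingIdeal Y) (vanishingIdeal C)).subschemeι).stalkMap_surjective v'))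
  let e₂ : (vanishingIdeal C).subscheme.presheaf.stalk (e.hom v') ≃+*
      (strictTransformIdeal π (vanishingIdeal Y) (vanishingIdeal C)).subscheme.presheaf.stalk v' :=
    (asIso (e.hom.stalkMap v')).commRingCatIsoToRingEquiv
  let e₃ := (Ideal.quotEquivOfEq hkerC.symm).trans (RingHom.quotientKerEquivOfSurjective
    ((vanishingIdeal C).subschemeι.stalkMap_surjective (e.hom v')))
  rw [ringKrullDim_eq_of_ringEquiv (e₁.trans (e₂.symm.trans e₃.symm))]
  exact ringKrullDim_quotient_span_pair_eq_one hc₀ (hdim _ ⟨hx₁C, hx₁Y⟩)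

/-- **`dim 𝒪_{X',c'} = 3`** at a point `c'` of the strict transform over a (threefold) point of `C ∩ Y`: `c'`
is residually rational over `π c'` (`exists_sub_stalkMap_mem_stalkIdeal_strictTransformIdeal_of_transverse`),
and regular local rings are universally catenary domains, so the dimension formula applies.
[cite: Matsumura1987, Thm. 15.6] [cite: CossartPiltant2008, Prop. 4.4 (proof, p. 10)] -/
theorem ringKrullDim_stalk_eq_three_of_transverse (hX : Scheme.IsRegular X)
    (v' : (strictTransformIdeal π (vanishingIdeal Y) (vanishingIdeal C)).subscheme)
    (hxY : π ((strictTransformIdeal π (vanishingIdeal Y) (vanishingIdeal C)).subschemeι v') ∈ (Y : Set X)) :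
    ringKrullDim (X'.presheaf.stalk ((strictTransformIdeal π (vanishingIdeal Y) (vanishingIdeal C)).subschemeι v')) = 3 := by
  haveI : IsRegularLocalRing (X.presheaf.stalk
      (π ((strictTransformIdeal π (vanishingIdeal Y) (vanishingIdeal C)).subschemeι v'))) := hX _
  haveI := isDomain_of_isRegularLocalRing (X.presheaf.stalk
    (π ((strictTransformIdeal π (vanishingIdeal Y) (vanishingIdeal C)).subschemeι v')))
  haveI : IsRegularRing (X.presheaf.stalk
      (π ((strictTransformIdeal π (vanishingIdeal Y) (vanishingIdeal C)).subschemeι v'))) :=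
    isRegularRing_of_isRegularLocalRing _
  have hc'C : π ((strictTransformIdeal π (vanishingIdeal Y) (vanishingIdeal C)).subschemeι v') ∈ (C : Set X) := by
    have h1 : (strictTransformIdeal π (vanishingIdeal Y) (vanishingIdeal C)).subschemeι v' ∈
        ((strictTransformIdeal π (vanishingIdeal Y) (vanishingIdeal C)).support : Set X') := by
      rw [← range_subschemeι]; exact Set.mem_range_self v'
    rw [support_strictTransformIdeal_eq_closure, coe_support_vanishingIdeal, coe_support_vanishingIdeal] at h1
    exact closure_minimal (Set.preimage_mono fun _ h => h.1) (C.isClosed.preimage π.continuous) h1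
  have h𝔓le : stalkIdeal (strictTransformIdeal π (vanishingIdeal Y) (vanishingIdeal C))
      ((strictTransformIdeal π (vanishingIdeal Y) (vanishingIdeal C)).subschemeι v') ≤ maximalIdeal _ := by
    refine (mem_support_iff_stalkIdeal_le _ _).mp ?_
    rw [← SetLike.mem_coe, ← range_subschemeι]; exact Set.mem_range_self v'
  rw [← hdim _ ⟨hc'C, hxY⟩]
  refine hπ.ringKrullDim_stalk_eq_of_residuallyRational_of_isDomain _
    (isUniversallyCatenaryRing_of_isRegularRing' _) fun y => ?_
  obtain ⟨a, ha⟩ :=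
    exists_sub_stalkMap_mem_stalkIdeal_strictTransformIdeal_of_transverse hπ hCreg htr hdim v' y
  exact ⟨a, h𝔓le ha⟩

/-- **[CoP1] p. 10: "note that under assumption (4) in lemma 4.3, the strict transform of `Σ` in `X′` is
transverse to the exceptional divisor, hence to `Γ′` if all components of `Γ` meet transversally".** For the
blowing up `π : X′ → X` of the regular locally Noetherian scheme `X` along a closed subset `Y` with regular
reduced structure, and a closed subset `C ⊆ X` whose reduced ideal is, at each of its points, generated by a
PAIR of elements of a regular system of parameters (a regular curve through threefold points) and which is
TRANSVERSE to `Y` where they meet (`𝓘_{C,x} + 𝓘_{Y,x} = 𝔪_x`) at threefold points (`dim 𝒪_{X,x} = 3`): at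
every point `c′` of the strict transform `C̃ = cl(π⁻¹(C ∖ Y))`, the reduced ideal of `C̃` is again generated
by a pair of elements of a regular system of parameters of `𝒪_{X′,c′}`, and if `c′` lies over `Y` then
`𝓘_{C̃,c′} + 𝓘_Y 𝒪_{X′,c′} = 𝔪_{c′}` (`C̃` is transverse to the exceptional divisor `E = π⁻¹(Y)`). Proof:
`𝓘_Y 𝒪_C` is an effective Cartier divisor on `C` (`isEffectiveCartier_comap_subschemeι_of_transverse`), so
the schematic strict transform `V(⋃ₙ (π^*𝓘_C : 𝓘_Eⁿ))` is `Bl_{𝓘_Y 𝒪_C} C ≅ C` over `X` (Stacks 080E/0807,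
`exists_iso_subscheme_strictTransformIdeal`); hence it is reduced (so its ideal is `𝓘_{C̃}`) and regular of
dimension one, and `𝒪_{X,π c′} → 𝒪_{X′,c′}/𝓘_{C̃,c′} ≅ 𝒪_{C,π c′}` is onto, which gives the transversality
and, by the dimension formula (`k(c′) = k(π c′)`; Matsumura 15.6), `dim 𝒪_{X′,c′} = 3`, so that
`𝓘_{C̃,c′}` needs exactly two regular parameters (Matsumura 14.2). Off `Y` the blowing up is a local
isomorphism. This is the brick T2c of the F-71 census (the chain-route stub
`stub_T2c_strictTransform_regular_transverse` follows by `exact`; its hypotheses `hYirr`, `hCirr`, `hCY`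
are not needed). [cite: CossartPiltant2008, Prop. 4.4 (proof, p. 10)] [cite: StacksProject, Tag 080E]
[cite: Matsumura1987, Thm. 15.6] -/
theorem exists_isRsopPart_strictTransform_of_transverse (hX : Scheme.IsRegular X)
    (hYreg : Scheme.IsRegular (vanishingIdeal Y).subscheme)
    {c' : X'} (hc' : c' ∈ closure (π ⁻¹' ((C : Set X) \ Y))) :
    (∃ c : Fin 2 → X'.presheaf.stalk c', IsRsopPart c ∧ Ideal.span (Set.range c) =
        stalkIdeal (vanishingIdeal
          (⟨closure (π ⁻¹' ((C : Set X) \ Y)), isClosed_closure⟩ : Closeds X')) c') ∧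
      (π c' ∈ (Y : Set X) →
        stalkIdeal (vanishingIdeal
            (⟨closure (π ⁻¹' ((C : Set X) \ Y)), isClosed_closure⟩ : Closeds X')) c' ⊔
          stalkIdeal ((vanishingIdeal Y).comap π) c' = maximalIdeal _) := by
  have hX'reg : Scheme.IsRegular X' := hπ.isRegular_of_isRegular_subscheme hX hYreg
  obtain ⟨hIeq, hI'reg⟩ := vanishingIdeal_closure_eq_strictTransformIdeal_of_transverse hπ hCreg htr hdim
  rw [hIeq]
  -- the point `c'` of the strict transform
  have hc'supp : c' ∈ (strictTransformIdeal π (vanishingIdeal Y) (vanishingIdeal C)).support := by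
    rw [← SetLike.mem_coe, support_strictTransformIdeal_eq_closure, coe_support_vanishingIdeal,
      coe_support_vanishingIdeal]
    exact hc'
  have hc'C : π c' ∈ (C : Set X) :=
    closure_minimal (Set.preimage_mono fun _ h => h.1) (C.isClosed.preimage π.continuous) hc'
  have h𝔓le : stalkIdeal (strictTransformIdeal π (vanishingIdeal Y) (vanishingIdeal C)) c' ≤ maximalIdeal _ :=
    (mem_support_iff_stalkIdeal_le _ _).mp hc'supp
  obtain ⟨v', hv'⟩ : c' ∈ Set.range (strictTransformIdeal π (vanishingIdeal Y) (vanishingIdeal C)).subschemeι := by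
    rw [range_subschemeι]
    exact hc'supp
  subst hv'
  haveI : IsRegularLocalRing (X'.presheaf.stalk
      ((strictTransformIdeal π (vanishingIdeal Y) (vanishingIdeal C)).subschemeι v')) := hX'reg _
  haveI : IsRegularLocalRing (X.presheaf.stalk
      (π ((strictTransformIdeal π (vanishingIdeal Y) (vanishingIdeal C)).subschemeι v'))) := hX _
  refine ⟨?_, fun hxY => ?_⟩
  · by_cases hxY : π ((strictTransformIdeal π (vanishingIdeal Y) (vanishingIdeal C)).subschemeι v') ∈ (Y : Set X)
    · -- over the centre: regular quotient of dimension `1` in a regular local ring of dimension `3`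
      haveI := isRegularLocalRing_stalk_quotient_stalkIdeal hI'reg hc'supp
      refine exists_isRsopPart_fin_span_range_eq h𝔓le ?_
      rw [ringKrullDim_stalk_quotient_strictTransformIdeal_of_transverse hπ hCreg htr hdim v' hxY,
        ringKrullDim_stalk_eq_three_of_transverse hπ hCreg htr hdim hX v' hxY]
      rfl
    · -- off the centre: `π` is a local isomorphism at `c'` and `𝓘_{C̃,c'} = 𝓘_C 𝒪_{X',c'}`
      have hxs : π ((strictTransformIdeal π (vanishingIdeal Y) (vanishingIdeal C)).subschemeι v') ∉
          ((vanishingIdeal Y).support : Set X) := by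
        rw [coe_support_vanishingIdeal]; exact hxY
      haveI := hπ.isIso_stalkMap_of_not_mem_support hxs
      let φ := (asIso (π.stalkMap
        ((strictTransformIdeal π (vanishingIdeal Y) (vanishingIdeal C)).subschemeι v'))).commRingCatIsoToRingEquiv
      obtain ⟨c₀, hc₀, hspan₀⟩ := hCreg _ hc'C
      refine ⟨φ ∘ c₀, hc₀.map_ringEquiv φ, ?_⟩
      rw [hπ.stalkIdeal_strictTransformIdeal_of_not_mem _ hxs, stalkIdeal_comap_eq_map_stalkMap, ← hspan₀,
        Ideal.map_span, Set.range_comp]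
      rfl
  · -- transversality: `𝔪_{c'} = 𝓘_{C̃,c'} + 𝓘_Y 𝒪_{X',c'}`, because `𝒪_{X,π c'} → 𝒪_{X',c'}/𝓘_{C̃,c'}` is onto
    -- and `𝔪_{π c'} = 𝓘_{C,π c'} + 𝓘_{Y,π c'}`
    apply le_antisymm
    · refine sup_le h𝔓le ((mem_support_iff_stalkIdeal_le _ _).mp ?_)
      rw [support_comap]
      change π _ ∈ ((vanishingIdeal Y).support : Set X)
      rw [coe_support_vanishingIdeal]
      exact hxY
    · intro y hy
      obtain ⟨a, ha⟩ :=
        exists_sub_stalkMap_mem_stalkIdeal_strictTransformIdeal_of_transverse hπ hCreg htr hdim v' y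
      have hya : (π.stalkMap _).hom a ∈ maximalIdeal _ := by
        have h := sub_mem hy (h𝔓le ha)
        rwa [sub_sub_cancel] at h
      have ha𝔪 : a ∈ maximalIdeal _ := by
        by_contra h
        have hu : IsUnit a := by
          by_contra hnu
          exact h ((IsLocalRing.mem_maximalIdeal a).mpr hnu)
        exact (IsLocalRing.mem_maximalIdeal _).mp hya (hu.map _)
      rw [← htr _ ⟨hc'C, hxY⟩] at ha𝔪
      obtain ⟨p, hp, q, hq, hpq⟩ := Submodule.mem_sup.mp ha𝔪
      have h1 : (π.stalkMap _).hom p ∈ stalkIdeal (strictTransformIdeal π (vanishingIdeal Y) (vanishingIdeal C))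
          ((strictTransformIdeal π (vanishingIdeal Y) (vanishingIdeal C)).subschemeι v') := by
        refine stalkIdeal_mono (comap_le_strictTransformIdeal π (vanishingIdeal Y) (vanishingIdeal C)) _ ?_
        rw [stalkIdeal_comap_eq_map_stalkMap]
        exact Ideal.mem_map_of_mem _ hp
      have h2 : (π.stalkMap _).hom q ∈ stalkIdeal ((vanishingIdeal Y).comap π)
          ((strictTransformIdeal π (vanishingIdeal Y) (vanishingIdeal C)).subschemeι v') := by
        rw [stalkIdeal_comap_eq_map_stalkMap]
        exact Ideal.mem_map_of_mem _ hq
      have hy' : y = (y - (π.stalkMap _).hom a) + ((π.stalkMap _).hom p + (π.stalkMap _).hom q) := by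
        rw [← map_add, hpq]; ring
      rw [hy']
      exact add_mem (Ideal.mem_sup_left ha) (add_mem (Ideal.mem_sup_left h1) (Ideal.mem_sup_right h2))

end StrictTransform

end Literature.AlgebraicGeometry.Resolution

end
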